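import Literature.NumberTheory.Sieve.MontgomeryVaughan1975Section6Main
import HarnessLib

/-!
# Montgomery–Vaughan (1975), §6, exceptional case, part T: the sum `T̃(η)` — PROVED

H. L. Montgomery, R. C. Vaughan, *The exceptional set in Goldbach's problem*, Acta Arith. 27
(1975) 353–370 [MontgomeryVaughanActa1975], §6, pp. 364–365. First layer of the discharge of the
second conjunct (6.1͂7) of the named fact `section6_formulae`: the analysis of
`T̃(η) = −∑_{P<k≤X} k^{β̃−1} e(kη)` (`excLinSum`), parallel to that of `T(η)` in `Section6C`.

* `norm_one_sub_mul_sum_Ioc_le` — Abel summation in telescoped form: for `|z| ≤ 1` and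
  `a_{M+1} ≥ a_{M+2} ≥ ⋯ ≥ 0`, `|(1 − z) ∑_{M<k≤B} a_k z^k| ≤ 2 a_{M+1}`;
* `norm_excLinSum_le` — p. 364 "By partial summation, `T̃(η) ≪ ‖η‖⁻¹`": `|T̃(η)| ≤ 1/(2|η|)` for
  `0 < |η| ≤ 1/2`, `β ≤ 1`;
* `integral_norm_excLinSum_sq_le` — **(6.7~)** `∫_{−h}^{h} |T̃|² ≤ ∫₀¹ |T̃|² = ∑ k^{2β̃−2} ≤ X`;
* `norm_integral_tails_le` — the tails `∫_{h≤|η|≤1/2} F ≤ 1/(2h)` for `|F(η)| ≤ (2|η|)⁻²`, whence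
  **(6.10~)** for `|T̃|²` and `|T T̃|`;
* `integral_excLinSum_mul_excLinSum_eq` — `∫_{−1/2}^{1/2} T̃² e(−nη) = Ĩ(n)` (`excPairSum`);
  `excCrossSum`, `integral_linSum_mul_excLinSum_eq` — `∫_{−1/2}^{1/2} T T̃ e(−nη) = −∑_{k+k'=n} k'^{β̃−1}`
  (this is `J̃(n)` of p. 364), `excCrossSum_le` — **(6.18)** `|J̃(n)| ≤ n`;
* `norm_integral_excLinSum_sq_sub_le`, `norm_integral_linSum_excLinSum_sub_le` — **(6.11~)**:
  `∫_{−h}^{h} T̃² e(−nη) = Ĩ(n) + O(1/h)`, `∫_{−h}^{h} T T̃ e(−nη) = J̃(n) + O(1/h)` with the constant `1/2`.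
-/

noncomputable section

open MeasureTheory Set Finset Real Complex Classical
open scoped FourierTransform ArithmeticFunction.Moebius

namespace Literature.NumberTheory.Sieve.MontgomeryVaughan1975

/-! ### Partial summation: `|T̃(η)| ≤ 1/(2|η|)` -/

/-- **Abel summation, telescoped**: for `|z| ≤ 1` and a sequence with `a_{M+1} ≥ a_{M+2} ≥ ⋯ ≥ 0`,
`|(1 − z) ∑_{M<k≤B} a_k z^k| ≤ 2 a_{M+1}` (the sum telescopes to `a_{M+1}z^{M+1} − a_B z^{B+1} +
∑ (a_k − a_{k−1}) z^k`). [folklore] -/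
theorem norm_one_sub_mul_sum_Ioc_le {a : ℕ → ℝ} {z : ℂ} (hz : ‖z‖ ≤ 1) {M : ℕ}
    (ha0 : ∀ k, M < k → 0 ≤ a k) (hmono : ∀ k, M < k → a (k + 1) ≤ a k) (B : ℕ) :
    ‖(1 - z) * ∑ k ∈ Finset.Ioc M B, ((a k : ℝ) : ℂ) * z ^ k‖ ≤ 2 * a (M + 1) := by
  have hzp : ∀ m : ℕ, ‖z‖ ^ m ≤ 1 := fun m => pow_le_one₀ (norm_nonneg _) hz
  rcases le_or_gt B M with hBM | hMB
  · rw [Finset.Ioc_eq_empty (by omega), Finset.sum_empty, mul_zero, norm_zero]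
    linarith [ha0 (M + 1) (by omega)]
  · -- `G(B) = (1 − z) Σ_{M<k≤B} a_k z^k + a_B z^{B+1}` satisfies `|G(B)| ≤ 2a_{M+1} − a_B`
    have key : ∀ B, M < B →
        ‖(1 - z) * ∑ k ∈ Finset.Ioc M B, ((a k : ℝ) : ℂ) * z ^ k + ((a B : ℝ) : ℂ) * z ^ (B + 1)‖ ≤
          2 * a (M + 1) - a B := by
      intro B hB
      induction B with
      | zero => omega
      | succ B ih =>
        rcases Nat.lt_or_ge M B with hlt | hge
        · have hG := ih hlt
          rw [Finset.sum_Ioc_succ_top (by omega : M ≤ B)]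
          have hid : (1 - z) * (∑ k ∈ Finset.Ioc M B, ((a k : ℝ) : ℂ) * z ^ k +
                ((a (B + 1) : ℝ) : ℂ) * z ^ (B + 1)) + ((a (B + 1) : ℝ) : ℂ) * z ^ (B + 1 + 1) =
              ((1 - z) * ∑ k ∈ Finset.Ioc M B, ((a k : ℝ) : ℂ) * z ^ k + ((a B : ℝ) : ℂ) * z ^ (B + 1)) +
                (((a (B + 1) : ℝ) : ℂ) - ((a B : ℝ) : ℂ)) * z ^ (B + 1) := by ring
          rw [hid]
          have hdiff : ‖(((a (B + 1) : ℝ) : ℂ) - ((a B : ℝ) : ℂ)) * z ^ (B + 1)‖ ≤ a B - a (B + 1) := by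
            rw [norm_mul, norm_pow, ← Complex.ofReal_sub, Complex.norm_real, Real.norm_eq_abs,
              abs_sub_comm, abs_of_nonneg (by linarith [hmono B hlt])]
            calc (a B - a (B + 1)) * ‖z‖ ^ (B + 1) ≤ (a B - a (B + 1)) * 1 :=
                  mul_le_mul_of_nonneg_left (hzp _) (by linarith [hmono B hlt])
              _ = _ := mul_one _
          calc _ ≤ ‖(1 - z) * ∑ k ∈ Finset.Ioc M B, ((a k : ℝ) : ℂ) * z ^ k + ((a B : ℝ) : ℂ) * z ^ (B + 1)‖ +
                ‖(((a (B + 1) : ℝ) : ℂ) - ((a B : ℝ) : ℂ)) * z ^ (B + 1)‖ := norm_add_le _ _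
            _ ≤ (2 * a (M + 1) - a B) + (a B - a (B + 1)) := add_le_add hG hdiff
            _ = 2 * a (M + 1) - a (B + 1) := by ring
        · have hBM : B = M := by omega
          subst hBM
          rw [Nat.Ioc_succ_singleton, Finset.sum_singleton]
          have hid : (1 - z) * (((a (B + 1) : ℝ) : ℂ) * z ^ (B + 1)) + ((a (B + 1) : ℝ) : ℂ) * z ^ (B + 1 + 1) =
              ((a (B + 1) : ℝ) : ℂ) * z ^ (B + 1) := by ring
          rw [hid, norm_mul, norm_pow, Complex.norm_real, Real.norm_eq_abs,
            abs_of_nonneg (ha0 _ (by omega))]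
          calc a (B + 1) * ‖z‖ ^ (B + 1) ≤ a (B + 1) * 1 :=
                mul_le_mul_of_nonneg_left (hzp _) (ha0 _ (by omega))
            _ = 2 * a (B + 1) - a (B + 1) := by ring
    have hK := key B hMB
    have hlast : ‖((a B : ℝ) : ℂ) * z ^ (B + 1)‖ ≤ a B := by
      rw [norm_mul, norm_pow, Complex.norm_real, Real.norm_eq_abs, abs_of_nonneg (ha0 _ hMB)]
      calc a B * ‖z‖ ^ (B + 1) ≤ a B * 1 := mul_le_mul_of_nonneg_left (hzp _) (ha0 _ hMB)
        _ = a B := mul_one _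
    calc ‖(1 - z) * ∑ k ∈ Finset.Ioc M B, ((a k : ℝ) : ℂ) * z ^ k‖
        = ‖((1 - z) * ∑ k ∈ Finset.Ioc M B, ((a k : ℝ) : ℂ) * z ^ k + ((a B : ℝ) : ℂ) * z ^ (B + 1)) -
            ((a B : ℝ) : ℂ) * z ^ (B + 1)‖ := by rw [add_sub_cancel_right]
      _ ≤ ‖(1 - z) * ∑ k ∈ Finset.Ioc M B, ((a k : ℝ) : ℂ) * z ^ k + ((a B : ℝ) : ℂ) * z ^ (B + 1)‖ +
            ‖((a B : ℝ) : ℂ) * z ^ (B + 1)‖ := norm_sub_le _ _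
      _ ≤ (2 * a (M + 1) - a B) + a B := add_le_add hK hlast
      _ = 2 * a (M + 1) := by ring

/-- `T̃(η)` as a weighted geometric sum: `T̃(η) = −∑_{⌊P⌋<k≤⌊X⌋} k^{β−1} e(η)^k`. [folklore] -/
theorem excLinSum_eq_neg_sum_pow {P X : ℝ} (hP : 0 ≤ P) (β η : ℝ) :
    excLinSum P X β η =
      -∑ k ∈ Finset.Ioc ⌊P⌋₊ ⌊X⌋₊, ((((k : ℝ) ^ (β - 1) : ℝ)) : ℂ) * ((𝐞 η : ℂ)) ^ k := by
  rw [excLinSum, intWindow_eq_Ioc hP]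
  congr 1
  refine Finset.sum_congr rfl fun k _ => ?_
  rw [← Circle.coe_pow, ← AddChar.map_nsmul_eq_pow, nsmul_eq_mul]

/-- **`|T̃(η)| ≤ 1/(2|η|)`** for `0 < |η| ≤ 1/2` and `β ≤ 1` (p. 364: "By partial summation,
`T̃(η) ≪ ‖η‖⁻¹`"; the weights `k^{β−1}` decrease and are `≤ 1`, and `|1 − e(η)| ≥ 4|η|`).
[cite: MontgomeryVaughanActa1975, §6 (6.10~)] -/
theorem norm_excLinSum_le {P X β η : ℝ} (hP : 0 ≤ P) (hβ : β ≤ 1) (hη0 : η ≠ 0) (hη : |η| ≤ 1 / 2) :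
    ‖excLinSum P X β η‖ ≤ 1 / (2 * |η|) := by
  set z : ℂ := (𝐞 η : ℂ) with hz
  have hz1 : ‖z‖ ≤ 1 := by rw [hz, Circle.norm_coe]
  set a : ℕ → ℝ := fun k => (k : ℝ) ^ (β - 1) with ha
  have ha0 : ∀ k, ⌊P⌋₊ < k → 0 ≤ a k := fun k _ => Real.rpow_nonneg (Nat.cast_nonneg k) _
  have hmono : ∀ k, ⌊P⌋₊ < k → a (k + 1) ≤ a k := by
    intro k hk
    simp only [ha]
    have hk0 : (0 : ℝ) < k := by exact_mod_cast (show 0 < k by omega)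
    push_cast
    exact Real.rpow_le_rpow_of_nonpos hk0 (by linarith) (by linarith)
  have hA := norm_one_sub_mul_sum_Ioc_le hz1 ha0 hmono ⌊X⌋₊
  have ha1 : a (⌊P⌋₊ + 1) ≤ 1 := by
    simp only [ha]
    push_cast
    exact Real.rpow_le_one_of_one_le_of_nonpos (by linarith [(Nat.cast_nonneg ⌊P⌋₊ : (0 : ℝ) ≤ ⌊P⌋₊)])
      (by linarith)
  have hsum : ‖excLinSum P X β η‖ = ‖∑ k ∈ Finset.Ioc ⌊P⌋₊ ⌊X⌋₊, ((a k : ℝ) : ℂ) * z ^ k‖ := by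
    rw [excLinSum_eq_neg_sum_pow hP, norm_neg]
  have hden := four_mul_abs_le_norm_fourierChar_sub_one hη
  have hden' : 4 * |η| ≤ ‖1 - z‖ := by rw [norm_sub_rev]; exact hden
  have hpos : 0 < 4 * |η| := by positivity
  have hprod : 4 * |η| * ‖excLinSum P X β η‖ ≤ 2 := by
    calc 4 * |η| * ‖excLinSum P X β η‖ ≤ ‖1 - z‖ * ‖∑ k ∈ Finset.Ioc ⌊P⌋₊ ⌊X⌋₊, ((a k : ℝ) : ℂ) * z ^ k‖ := by
          rw [hsum]; exact mul_le_mul_of_nonneg_right hden' (norm_nonneg _)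
      _ = ‖(1 - z) * ∑ k ∈ Finset.Ioc ⌊P⌋₊ ⌊X⌋₊, ((a k : ℝ) : ℂ) * z ^ k‖ := (norm_mul _ _).symm
      _ ≤ 2 * a (⌊P⌋₊ + 1) := hA
      _ ≤ 2 := by linarith
  rw [le_div_iff₀ (by positivity)]
  nlinarith [norm_nonneg (excLinSum P X β η)]

/-! ### (6.7~): `∫_{−h}^{h} |T̃|² ≤ X` -/

/-- `T̃(η)` as a trigonometric polynomial with coefficients `−k^{β−1}`. [folklore] -/
theorem excLinSum_eq_trigPoly (P X β η : ℝ) :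
    excLinSum P X β η =
      ∑ k ∈ intWindow P X, (-((((k : ℝ) ^ (β - 1) : ℝ)) : ℂ)) * (𝐞 (k * η) : ℂ) := by
  rw [excLinSum, ← Finset.sum_neg_distrib]
  refine Finset.sum_congr rfl fun k _ => ?_
  ring

/-- The weights: `0 ≤ k^{β−1} ≤ 1` on the window (`k ≥ 1`, `β ≤ 1`). [folklore] -/
theorem rpow_window_le_one {P X β : ℝ} (hβ : β ≤ 1) {k : ℕ} (hk : k ∈ intWindow P X) :
    0 ≤ (k : ℝ) ^ (β - 1) ∧ (k : ℝ) ^ (β - 1) ≤ 1 := by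
  rw [mem_intWindow] at hk
  have hk1 : (1 : ℝ) ≤ k := by exact_mod_cast hk.1.1
  exact ⟨Real.rpow_nonneg (by linarith) _, Real.rpow_le_one_of_one_le_of_nonpos hk1 (by linarith)⟩

/-- **(6.7~)** `∫_{−h}^{h} |T̃(η)|² dη ≤ ∫ over a unit interval = ∑_{P<k≤X} k^{2β−2} ≤ X` for
`0 ≤ h ≤ 1/2`, `β ≤ 1`. [cite: MontgomeryVaughanActa1975, §6 (6.7~)] -/
theorem integral_norm_excLinSum_sq_le {P X β h : ℝ} (hh0 : 0 ≤ h) (hh : h ≤ 1 / 2) (hX : 0 ≤ X)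
    (hβ : β ≤ 1) : ∫ η in (-h)..h, ‖excLinSum P X β η‖ ^ 2 ≤ X := by
  have hpars : ∫ η in (-(1 / 2 : ℝ))..(-(1 / 2 : ℝ)) + 1, ‖excLinSum P X β η‖ ^ 2 =
      ∑ k ∈ intWindow P X, ‖(-((((k : ℝ) ^ (β - 1) : ℝ)) : ℂ))‖ ^ 2 := by
    have h := integral_norm_trigPoly_sq (intWindow P X) (fun k => -((((k : ℝ) ^ (β - 1) : ℝ)) : ℂ))
      (-(1 / 2 : ℝ))
    rw [← h]
    refine intervalIntegral.integral_congr fun η _ => ?_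
    simp only [excLinSum_eq_trigPoly]
  have hcont : Continuous fun η : ℝ => ‖excLinSum P X β η‖ ^ 2 := by unfold excLinSum; fun_prop
  calc ∫ η in (-h)..h, ‖excLinSum P X β η‖ ^ 2
      ≤ ∫ η in (-(1 / 2 : ℝ))..(-(1 / 2 : ℝ)) + 1, ‖excLinSum P X β η‖ ^ 2 := by
        apply intervalIntegral.integral_mono_interval (by linarith) (by linarith) (by linarith)
          (Filter.Eventually.of_forall fun η => sq_nonneg _) (hcont.intervalIntegrable _ _)
    _ = ∑ k ∈ intWindow P X, ‖(-((((k : ℝ) ^ (β - 1) : ℝ)) : ℂ))‖ ^ 2 := hpars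
    _ ≤ ∑ k ∈ intWindow P X, (1 : ℝ) := by
        refine Finset.sum_le_sum fun k hk => ?_
        obtain ⟨h0, h1⟩ := rpow_window_le_one (P := P) (X := X) hβ hk
        rw [norm_neg, Complex.norm_real, Real.norm_eq_abs, abs_of_nonneg h0]
        calc ((k : ℝ) ^ (β - 1)) ^ 2 ≤ (1 : ℝ) ^ 2 := pow_le_pow_left₀ h0 h1 2
          _ = 1 := one_pow 2
    _ = (intWindow P X).card := by rw [Finset.sum_const, nsmul_eq_mul, mul_one]
    _ ≤ X := card_intWindow_le hX

/-- `(∫_{−h}^{h} |T̃|²)^{1/2} ≤ X^{1/2}` for `0 ≤ h ≤ 1/2`. [cite: MontgomeryVaughanActa1975, §6 (6.7~)] -/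
theorem rpow_integral_norm_excLinSum_sq_le {P X β h : ℝ} (hh0 : 0 ≤ h) (hh : h ≤ 1 / 2) (hX : 0 ≤ X)
    (hβ : β ≤ 1) :
    (∫ η in (-h)..h, ‖excLinSum P X β η‖ ^ 2) ^ (1 / 2 : ℝ) ≤ X ^ (1 / 2 : ℝ) :=
  Real.rpow_le_rpow (intervalIntegral.integral_nonneg (by linarith) fun η _ => sq_nonneg _)
    (integral_norm_excLinSum_sq_le hh0 hh hX hβ) (by norm_num)

/-! ### (6.10~): the tails -/

/-- **The tails**: if `|F(η)| ≤ (2|η|)⁻²` for `h ≤ |η| ≤ 1/2` (`F` continuous, `0 < h ≤ 1/2`), then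
`|∫_{h}^{1/2} F| ≤ 1/(4h)` and `|∫_{−1/2}^{−h} F| ≤ 1/(4h)`. [cite: MontgomeryVaughanActa1975, §6 (6.10)] -/
theorem norm_integral_tails_le {F : ℝ → ℂ} (hF : Continuous F) {h : ℝ} (hh : 0 < h) (hh2 : h ≤ 1 / 2)
    (hb : ∀ η : ℝ, h ≤ |η| → |η| ≤ 1 / 2 → ‖F η‖ ≤ (1 / (2 * |η|)) ^ 2) :
    ‖∫ η in h..(1 / 2 : ℝ), F η‖ ≤ 1 / (4 * h) ∧ ‖∫ η in (-(1 / 2 : ℝ))..(-h), F η‖ ≤ 1 / (4 * h) := by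
  have hcont2 : ContinuousOn (fun η : ℝ => (1 / (2 * |η|)) ^ 2) (Set.Icc h (1 / 2)) := by
    refine ContinuousOn.pow (continuousOn_const.div (by fun_prop) fun η hη => ?_) 2
    have : 0 < η := hh.trans_le hη.1
    positivity
  constructor
  · refine (intervalIntegral.norm_integral_le_integral_norm hh2).trans ?_
    calc ∫ η in h..(1 / 2 : ℝ), ‖F η‖ ≤ ∫ η in h..(1 / 2 : ℝ), (1 / (2 * |η|)) ^ 2 := by
          apply intervalIntegral.integral_mono_on hh2 (hF.norm.intervalIntegrable _ _)
            (hcont2.intervalIntegrable_of_Icc hh2)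
          intro η hη
          exact hb η (by rw [abs_of_pos (hh.trans_le hη.1)]; exact hη.1)
            (by rw [abs_of_pos (hh.trans_le hη.1)]; exact hη.2)
      _ ≤ 1 / (4 * h) := integral_inv_two_mul_sq_le hh hh2
  · refine (intervalIntegral.norm_integral_le_integral_norm (by linarith)).trans ?_
    have hsymm : ∫ η in (-(1 / 2 : ℝ))..(-h), ‖F η‖ = ∫ η in h..(1 / 2 : ℝ), ‖F (-η)‖ := by
      rw [← intervalIntegral.integral_comp_neg fun η => ‖F η‖]
    rw [hsymm]
    have hF' : Continuous fun η : ℝ => ‖F (-η)‖ := (hF.comp continuous_neg).norm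
    calc ∫ η in h..(1 / 2 : ℝ), ‖F (-η)‖ ≤ ∫ η in h..(1 / 2 : ℝ), (1 / (2 * |η|)) ^ 2 := by
          apply intervalIntegral.integral_mono_on hh2 (hF'.intervalIntegrable _ _)
            (hcont2.intervalIntegrable_of_Icc hh2)
          intro η hη
          have := hb (-η) (by rw [abs_neg, abs_of_pos (hh.trans_le hη.1)]; exact hη.1)
            (by rw [abs_neg, abs_of_pos (hh.trans_le hη.1)]; exact hη.2)
          rwa [abs_neg] at this
      _ ≤ 1 / (4 * h) := integral_inv_two_mul_sq_le hh hh2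

/-! ### The unit-interval integrals `Ĩ(n)` and `J̃(n)` -/

/-- **`Ĩ(n) = ∫_{−1/2}^{1/2} T̃(η)² e(−nη) dη`** (definition of `Ĩ` on p. 364, by 1-periodicity on any
unit interval; orthogonality). [cite: MontgomeryVaughanActa1975, §6 (6.18)] -/
theorem integral_excLinSum_mul_excLinSum_eq (P X β : ℝ) (n : ℕ) :
    ∫ η in (-(1 / 2 : ℝ))..(-(1 / 2 : ℝ)) + 1,
        excLinSum P X β η * excLinSum P X β η * (𝐞 (-(n * η)) : ℂ) = (excPairSum P X β n : ℂ) := by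
  have h := integral_trigPoly_mul_trigPoly (intWindow P X) (intWindow P X)
    (fun k => -((((k : ℝ) ^ (β - 1) : ℝ)) : ℂ)) (fun k => -((((k : ℝ) ^ (β - 1) : ℝ)) : ℂ)) (-(1 / 2 : ℝ)) n
  simp_rw [excLinSum_eq_trigPoly]
  rw [h, excPairSum]
  push_cast
  refine Finset.sum_congr rfl fun k₁ _ => Finset.sum_congr rfl fun k₂ _ => ?_
  split_ifs
  · rw [Real.mul_rpow (Nat.cast_nonneg k₁) (Nat.cast_nonneg k₂)]; push_cast; ring
  · rfl

/-- `−J̃(n) = ∑∑_{P<k,k'≤X, k+k'=n} k'^{β̃−1}` (so that `J̃(n) = ∫₀¹ T(η) T̃(η) e(−nη) dη`, p. 364, is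
`−excCrossSum`, `integral_linSum_mul_excLinSum_eq`). [cite: MontgomeryVaughanActa1975, §6 (6.18)] -/
def excCrossSum (P X β : ℝ) (n : ℕ) : ℝ :=
  ∑ k ∈ intWindow P X, ∑ k' ∈ intWindow P X, if k + k' = n then ((k' : ℝ)) ^ (β - 1) else 0

/-- **`J̃(n) = ∫_{−1/2}^{1/2} T(η) T̃(η) e(−nη) dη = −∑_{k+k'=n} k'^{β̃−1}`** (orthogonality).
[cite: MontgomeryVaughanActa1975, §6 (6.18)] -/
theorem integral_linSum_mul_excLinSum_eq (P X β : ℝ) (n : ℕ) :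
    ∫ η in (-(1 / 2 : ℝ))..(-(1 / 2 : ℝ)) + 1,
        linSum P X η * excLinSum P X β η * (𝐞 (-(n * η)) : ℂ) = -(excCrossSum P X β n : ℂ) := by
  have h := integral_trigPoly_mul_trigPoly (intWindow P X) (intWindow P X) (fun _ => (1 : ℂ))
    (fun k => -((((k : ℝ) ^ (β - 1) : ℝ)) : ℂ)) (-(1 / 2 : ℝ)) n
  simp only [one_mul] at h
  have hT : ∀ η : ℝ, linSum P X η = ∑ k ∈ intWindow P X, (𝐞 (k * η) : ℂ) := fun η => rfl
  simp_rw [hT, excLinSum_eq_trigPoly]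
  rw [h, excCrossSum]
  push_cast
  rw [← Finset.sum_neg_distrib]
  refine Finset.sum_congr rfl fun k₁ _ => ?_
  rw [← Finset.sum_neg_distrib]
  refine Finset.sum_congr rfl fun k₂ _ => ?_
  split_ifs
  · rfl
  · simp

/-- `0 ≤ −J̃(n)`. [folklore] -/
theorem excCrossSum_nonneg (P X β : ℝ) (n : ℕ) : 0 ≤ excCrossSum P X β n := by
  refine Finset.sum_nonneg fun k _ => Finset.sum_nonneg fun k' _ => ?_
  split_ifs
  · positivity
  · exact le_rfl

/-- **(6.18)** `|J̃(n)| ≤ n` (`≤ X` for `n ≤ X`): at most `ν(n) ≤ n` pairs, each weight `k'^{β−1} ≤ 1`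
(`β ≤ 1`). [cite: MontgomeryVaughanActa1975, §6 (6.18)] -/
theorem excCrossSum_le {P X β : ℝ} (hβ : β ≤ 1) (n : ℕ) : excCrossSum P X β n ≤ n := by
  have h1 : excCrossSum P X β n ≤ (pairCount P X n : ℝ) := by
    rw [excCrossSum, pairCount, Finset.card_filter, Nat.cast_sum, Finset.sum_product]
    refine Finset.sum_le_sum fun k _ => Finset.sum_le_sum fun k' hk' => ?_
    split_ifs
    · simpa using (rpow_window_le_one (P := P) (X := X) hβ hk').2
    · simp
  exact h1.trans (by exact_mod_cast pairCount_le P X n)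

/-! ### (6.11~): the arc integrals of `T̃²` and `T T̃` -/

/-- The norm of `T̃² e(−nη)` is `|T̃|²`. [folklore] -/
theorem norm_excLinSum_mul_excLinSum_mul (P X β : ℝ) (n : ℕ) (η : ℝ) :
    ‖excLinSum P X β η * excLinSum P X β η * (𝐞 (-(n * η)) : ℂ)‖ = ‖excLinSum P X β η‖ ^ 2 := by
  rw [norm_mul, norm_mul, Circle.norm_coe, mul_one, sq]

/-- The norm of `T T̃ e(−nη)` is `|T| |T̃|`. [folklore] -/
theorem norm_linSum_mul_excLinSum_mul (P X β : ℝ) (n : ℕ) (η : ℝ) :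
    ‖linSum P X η * excLinSum P X β η * (𝐞 (-(n * η)) : ℂ)‖ = ‖linSum P X η‖ * ‖excLinSum P X β η‖ := by
  rw [norm_mul, norm_mul, Circle.norm_coe, mul_one]

/-- Splitting a unit-interval integral at `±h` and bounding the tails: if `∫_{−1/2}^{1/2} F = V` and
both tails are `≤ 1/(4h)` in norm then `|∫_{−h}^{h} F − V| ≤ 1/(2h)` (`h > 0`). [folklore] -/
theorem norm_integral_sub_le_of_tails {F : ℝ → ℂ} (hF : Continuous F) {h : ℝ} (hh : 0 < h)
    {V : ℂ} (hfull : ∫ η in (-(1 / 2 : ℝ))..(-(1 / 2 : ℝ)) + 1, F η = V)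
    (ht1 : ‖∫ η in h..(1 / 2 : ℝ), F η‖ ≤ 1 / (4 * h))
    (ht2 : ‖∫ η in (-(1 / 2 : ℝ))..(-h), F η‖ ≤ 1 / (4 * h)) :
    ‖(∫ η in (-h)..h, F η) - V‖ ≤ 1 / (2 * h) := by
  have hii : ∀ a b : ℝ, IntervalIntegrable F volume a b := fun a b => hF.intervalIntegrable a b
  rw [show -(1 / 2 : ℝ) + 1 = 1 / 2 by norm_num] at hfull
  have hsplit : ∫ η in (-(1 / 2 : ℝ))..(1 / 2 : ℝ), F η =
      (∫ η in (-(1 / 2 : ℝ))..(-h), F η) + (∫ η in (-h)..h, F η) + ∫ η in h..(1 / 2 : ℝ), F η := by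
    rw [intervalIntegral.integral_add_adjacent_intervals (hii _ _) (hii _ _),
      intervalIntegral.integral_add_adjacent_intervals (hii _ _) (hii _ _)]
  have hmid : (∫ η in (-h)..h, F η) - V =
      -(∫ η in (-(1 / 2 : ℝ))..(-h), F η) - ∫ η in h..(1 / 2 : ℝ), F η := by
    rw [← hfull, hsplit]; ring
  rw [hmid]
  calc ‖-(∫ η in (-(1 / 2 : ℝ))..(-h), F η) - ∫ η in h..(1 / 2 : ℝ), F η‖
      ≤ ‖-(∫ η in (-(1 / 2 : ℝ))..(-h), F η)‖ + ‖∫ η in h..(1 / 2 : ℝ), F η‖ := norm_sub_le _ _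
    _ ≤ 1 / (4 * h) + 1 / (4 * h) := by rw [norm_neg]; exact add_le_add ht2 ht1
    _ = 1 / (2 * h) := by field_simp; ring

/-- **(6.11~), first integral**: `|∫_{−h}^{h} T̃(η)² e(−nη) dη − Ĩ(n)| ≤ 1/(2h)` for `0 < h ≤ 1/2`,
`β ≤ 1` (p. 364: "the integrals in (6.4~) are respectively `Ĩ(n) + O(qQ)` …", `h = 1/(qQ)`).
[cite: MontgomeryVaughanActa1975, §6 (6.11~)] -/
theorem norm_integral_excLinSum_sq_sub_le {P X β h : ℝ} (hP : 0 ≤ P) (hβ : β ≤ 1) (hh : 0 < h)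
    (hh2 : h ≤ 1 / 2) (n : ℕ) :
    ‖(∫ η in (-h)..h, excLinSum P X β η * excLinSum P X β η * (𝐞 (-(n * η)) : ℂ)) -
        (excPairSum P X β n : ℂ)‖ ≤ 1 / (2 * h) := by
  have hFc : Continuous fun η : ℝ => excLinSum P X β η * excLinSum P X β η * (𝐞 (-(n * η)) : ℂ) := by
    unfold excLinSum; fun_prop
  have hpt : ∀ η : ℝ, h ≤ |η| → |η| ≤ 1 / 2 →
      ‖excLinSum P X β η * excLinSum P X β η * (𝐞 (-(n * η)) : ℂ)‖ ≤ (1 / (2 * |η|)) ^ 2 := by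
    intro η h1 h2
    have hη0 : η ≠ 0 := by intro h0; rw [h0, abs_zero] at h1; linarith
    rw [norm_excLinSum_mul_excLinSum_mul]
    exact pow_le_pow_left₀ (norm_nonneg _) (norm_excLinSum_le hP hβ hη0 h2) 2
  obtain ⟨ht1, ht2⟩ := norm_integral_tails_le hFc hh hh2 hpt
  exact norm_integral_sub_le_of_tails hFc hh (integral_excLinSum_mul_excLinSum_eq P X β n) ht1 ht2

/-- **(6.11~), second integral**: `|∫_{−h}^{h} T(η) T̃(η) e(−nη) dη − J̃(n)| ≤ 1/(2h)` for
`0 < h ≤ 1/2`, `β ≤ 1`, with `J̃(n) = −excCrossSum`. [cite: MontgomeryVaughanActa1975, §6 (6.11~)] -/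
theorem norm_integral_linSum_excLinSum_sub_le {P X β h : ℝ} (hP : 0 ≤ P) (hβ : β ≤ 1) (hh : 0 < h)
    (hh2 : h ≤ 1 / 2) (n : ℕ) :
    ‖(∫ η in (-h)..h, linSum P X η * excLinSum P X β η * (𝐞 (-(n * η)) : ℂ)) -
        (-(excCrossSum P X β n : ℂ))‖ ≤ 1 / (2 * h) := by
  have hFc : Continuous fun η : ℝ => linSum P X η * excLinSum P X β η * (𝐞 (-(n * η)) : ℂ) := by
    unfold excLinSum linSum; fun_prop
  have hpt : ∀ η : ℝ, h ≤ |η| → |η| ≤ 1 / 2 →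
      ‖linSum P X η * excLinSum P X β η * (𝐞 (-(n * η)) : ℂ)‖ ≤ (1 / (2 * |η|)) ^ 2 := by
    intro η h1 h2
    have hη0 : η ≠ 0 := by intro h0; rw [h0, abs_zero] at h1; linarith
    rw [norm_linSum_mul_excLinSum_mul, sq]
    exact mul_le_mul (norm_linSum_le hP hη0 h2) (norm_excLinSum_le hP hβ hη0 h2) (norm_nonneg _)
      (by positivity)
  obtain ⟨ht1, ht2⟩ := norm_integral_tails_le hFc hh hh2 hpt
  exact norm_integral_sub_le_of_tails hFc hh (integral_linSum_mul_excLinSum_eq P X β n) ht1 ht2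

end Literature.NumberTheory.Sieve.MontgomeryVaughan1975
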